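import Summits.CriticalPhenomena.PercolationContinuityZ3.Theorems.PercNearOneGluingNoHeavyQuantFarSunGame
import Mathlib.Tactic.IntervalCases
import HarnessLib

/-!
# FAR beyond trees: REGION I CERTIFICATES — the delay-2 binary count games for the boxes `[η₁(K), 1]^K`, `K = 17, 18, 19, 20`

builds on p205010 (kernel theorem, internal audit signed; external expert review pending)

Support file (`--supports stmt-CriticalPhenomena-4575`), seat `prim-cert-1` (gen 39); memo `prim-cert-1/FROM-prim-cert-1-g39-VERTEX-GAME.md` §0(iv), §5.
COMPUTATIONAL (`native_decide`).  For each `K` below, the game of `…QuantFarSunGame` with letters `{η₁(K), 1}` (weights `0, 1`), budgets `0 … K`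
(= number of sure letters) passes: `gameCert K K (range (K+1)) = true`, together with the well-formedness of the specification.  By
`GameSpec.autoE_nonneg_of_gameCert` (…GameSound), `HairyCycle.sum_hairW_flankPay_nonneg_of_gameCert` (…GameLink) and `HairyCycle.witGavg_ge_one_of_boxCert`
(…GameAvg) this gives `1 ≤ witGavg K h 2` on the whole box `η₁(K) ≤ h k ≤ 1` (the vertex principle, …Vertex).  Thresholds (exact enumeration, memo §0(i)):
η₀(K) < η₁(K) with η₁ = 17: 3/16, 18: 7/40, 19: 7/40, 20: 3/20.  Caps are the minimal ones found exact-sufficient (seat folder work/dpc/certplan.py; kit j220495).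
Elementary [this work]; no sorries; axioms standard + `Lean.ofReduceBool` (native_decide).
-/

namespace Summit.CriticalPhenomena.PercolationContinuityZ3.Theorems.HairyCycle

/-- Region I certificate, `K = 17`, box `[3/16, 1]^17` (caps `(10,6,8)`, `Lpay = 420`): all budgets `0..17` pass. [this work] -/
theorem boxCert_17 : (⟨10, 6, 8, 17, 16, 420, [(3, 0), (16, 1)]⟩ : GameSpec).gameCert 17 17 (List.range 18) = true := by
  native_decide

/-- Its specification is well formed. [this work] -/
theorem boxWF_17 : (⟨10, 6, 8, 17, 16, 420, [(3, 0), (16, 1)]⟩ : GameSpec).WF where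
  q_pos := by decide
  k_le := by
    intro i hi
    have : i < 2 := hi
    interval_cases i <;> decide
  Kcred4 := by decide
  Lpay_pos := by decide
  dvdA := by
    intro d h1 h2
    change d + 4 ≤ 10 at h2
    have h3 : d ≤ 6 := by omega
    interval_cases d <;> decide
  dvdK := by decide

/-- Region I certificate, `K = 18`, box `[7/40, 1]^18` (caps `(10,6,8)`, `Lpay = 60`): all budgets `0..18` pass. [this work] -/
theorem boxCert_18 : (⟨10, 6, 8, 18, 40, 60, [(7, 0), (40, 1)]⟩ : GameSpec).gameCert 18 18 (List.range 19) = true := by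
  native_decide

/-- Its specification is well formed. [this work] -/
theorem boxWF_18 : (⟨10, 6, 8, 18, 40, 60, [(7, 0), (40, 1)]⟩ : GameSpec).WF where
  q_pos := by decide
  k_le := by
    intro i hi
    have : i < 2 := hi
    interval_cases i <;> decide
  Kcred4 := by decide
  Lpay_pos := by decide
  dvdA := by
    intro d h1 h2
    change d + 4 ≤ 10 at h2
    have h3 : d ≤ 6 := by omega
    interval_cases d <;> decide
  dvdK := by decide

/-- Region I certificate, `K = 19`, box `[7/40, 1]^19` (caps `(8,4,6)`, `Lpay = 48`): all budgets `0..19` pass. [this work] -/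
theorem boxCert_19 : (⟨8, 4, 6, 19, 40, 48, [(7, 0), (40, 1)]⟩ : GameSpec).gameCert 19 19 (List.range 20) = true := by
  native_decide

/-- Its specification is well formed. [this work] -/
theorem boxWF_19 : (⟨8, 4, 6, 19, 40, 48, [(7, 0), (40, 1)]⟩ : GameSpec).WF where
  q_pos := by decide
  k_le := by
    intro i hi
    have : i < 2 := hi
    interval_cases i <;> decide
  Kcred4 := by decide
  Lpay_pos := by decide
  dvdA := by
    intro d h1 h2
    change d + 4 ≤ 8 at h2
    have h3 : d ≤ 4 := by omega
    interval_cases d <;> decide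
  dvdK := by decide

/-- Region I certificate, `K = 20`, box `[3/20, 1]^20` (caps `(10,6,8)`, `Lpay = 1020`): all budgets `0..20` pass. [this work] -/
theorem boxCert_20 : (⟨10, 6, 8, 20, 20, 1020, [(3, 0), (20, 1)]⟩ : GameSpec).gameCert 20 20 (List.range 21) = true := by
  native_decide

/-- Its specification is well formed. [this work] -/
theorem boxWF_20 : (⟨10, 6, 8, 20, 20, 1020, [(3, 0), (20, 1)]⟩ : GameSpec).WF where
  q_pos := by decide
  k_le := by
    intro i hi
    have : i < 2 := hi
    interval_cases i <;> decide
  Kcred4 := by decide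
  Lpay_pos := by decide
  dvdA := by
    intro d h1 h2
    change d + 4 ≤ 10 at h2
    have h3 : d ≤ 6 := by omega
    interval_cases d <;> decide
  dvdK := by decide

end Summit.CriticalPhenomena.PercolationContinuityZ3.Theorems.HairyCycle
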